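import Mathlib
import HarnessLib
import Literature.NumberTheory.EllipticCurves.Szpiro

/-!
# Crux `RibetTakahashiSplit.ThinWeightedSzpiro` (stmt-ABC-17927), line `Sketch` (idea
`thin-strong-hall-transfer`): objects of the line — the ℕ normal form "thin strong Hall"

Definitions used by the checked skeleton `Cruxes/ThinWeightedSzpiro/Lines/Sketch.lean` (lead
prover-line-stmt-ABC-17927-0, registered with `ledger skeleton check`, 2026-08-17) and by the files that
prove its registered stubs. They are moved here verbatim from the skeleton (CONVENTIONS §6: route-posited
objects live in a reviewed `…Defs` file, never in a proof file), so that the stub files, the calibration files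
and the closing file share ONE vocabulary.

The line strips the crux r3″ (thin-class weighted Szpiro with a frozen class exponent, route decl
`Summit.ABC.ABC.Theses.RibetTakahashiSplit.ThinWeightedSzpiro`) of every elliptic-curve word: with
`x = c₄(W₀)`, `y = c₆(W₀)`, `z = x³ − y² = 1728·Δ(W₀)` (Mathlib `WeierstrassCurve.c_relation`), minimality and
semistability of a global minimal model semistable away from `2` become side conditions on `(x, y, z)`, the
conductor is squeezed between `rad5 z` and `768·rad5 z`, and the crux's exponent product dominates `wt5 z`.
The three bookkeeping stubs making this precise are LANDED:
`Summits/ABC/ABC/Theorems/RibetTakahashiSplitThinWeightedSzpiroStub{LocalData,Weights,Transfer}.lean`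
(p147685, p147744, p147670); together they prove `ThinStrongHall → ThinWeightedSzpiro` (composed in the
skeleton). What is left of the crux is `ThinStrongHall` itself, split into a cusp half (`|z| ≤ |x|³`, the Hall
corner, `|j| ≥ 1728`) and a bulk half (`|x|³ < |z|`), both research statements of abc-strength (Bombieri–Gubler
Conj. 12.5.3 restricted to the thin class and weighted by the exponent product; the calibration files attached
to the item prove `StrongHallConjecture → ThinStrongHall` and exhibit open consequences of each half).

Contents:
* `rad5 z`, `wt5 z` — radical and exponent product of the prime-to-`6` part of `z`;
* `Prim23 x y` — the normalisation at `2, 3` that minimality of a model with invariants `(c₄, c₆) = (x, y)`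
  gives (without SOME normalisation the ℕ form is trivially false: `(x, y) ↦ (d⁴x, d⁶y)` fixes `rad5, wt5`);
* `HallIneq R θ ε K C`, `ThinLaw R` (`∃θ>0 ∀ε>0 ∀K ∃C`, the crux's quantifier shape, class exponent frozen
  outside `∀ε ∀K`), `ThinStrongHall`, `ThinStrongHallCusp`, `ThinStrongHallBulk`;
* elementary API: `one_le_rad5`, `one_le_wt5`, `thin_mono`, `ThinLaw.mono`, the regime glue
  `thinStrongHall_of_cusp_of_bulk` (= the registered glue stub `stub_glue` of the skeleton) /
  `thinStrongHall_iff_cusp_and_bulk`, and `freyCurve_cusp` (`1728·Δ ≤ c₄³` for every Frey–Hellegouarch curve: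
  Frey curves never enter the bulk).

No theorem of substance is proved here (the glue is two-line bookkeeping). These `def … : Prop` are objects
POSITED by the line (open statements), not published facts — hence no `[cite]` tags.
-/

-- `Summit.<Summit>.<Problem>` is the mandated summit-side namespace (CONVENTIONS §2); for the
-- single-conjunct summit `ABC` the two coincide, so the duplicate `ABC.ABC` is deliberate.
set_option linter.dupNamespace false

namespace Summit.ABC.ABC.Theorems.ThinWeightedSzpiro

open Literature.NumberTheory.EllipticCurves

/-! ## The objects -/

/-- Radical of the prime-to-`6` part of `z`: `rad5 z = ∏_{p ≥ 5, p ∣ z} p` (empty product `= 1`, also for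
`z = 0`). For `z = 1728·Δ(W₀)` of a global minimal model semistable away from `2` this is the odd part of the
conductor away from `3` (`rad5 z ∣ N ∣ 768·rad5 z`, stub `stub_weights`). -/
def rad5 (z : ℤ) : ℕ := ∏ p ∈ z.natAbs.primeFactors with 5 ≤ p, p

/-- Exponent weight of the prime-to-`6` part of `z`: `wt5 z = ∏_{p ≥ 5, p ∣ z} v_p(z)` (empty product `= 1`).
For `z = 1728·Δ(W₀)` as above, `wt5 z ≤ T(W₀) = ∏_{p ∥ N} ord_p(Δ_min)` (stub `stub_weights`). -/
def wt5 (z : ℤ) : ℕ := ∏ p ∈ z.natAbs.primeFactors with 5 ≤ p, z.natAbs.factorization p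

/-- PRIMITIVITY at `2` and `3` of a pair `(x, y)` (think `(c₄, c₆)`): not (`2⁸ ∣ x ∧ 2¹¹ ∣ y ∧ 2¹²·1728 ∣ x³ − y²`)
and not (`3⁴ ∣ x ∧ 3⁹ ∣ y ∧ 3¹²·1728 ∣ x³ − y²`). Minimality of an integral model with invariants
`(c₄, c₆) = (x, y)` at `2` resp. `3` implies it (`¬(2⁸ ∣ c₄ ∧ 2¹¹ ∣ c₆)`, `¬(3⁵ ∣ c₄ ∧ 3⁹ ∣ c₆)`, Silverman AEC
Ex. 8.21, tree `WeierstrassCurve.not_pow_dvd_c₄_c₆_of_isMinimalAt_two/_three`; stub `stub_localData`). Some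
normalisation at `2, 3` is necessary for the ℕ form: `(x, y) ↦ (d⁴x, d⁶y)` fixes `rad5` and `wt5`. -/
def Prim23 (x y : ℤ) : Prop :=
  ¬ ((2 : ℤ) ^ 8 ∣ x ∧ (2 : ℤ) ^ 11 ∣ y ∧ (2 : ℤ) ^ 12 * 1728 ∣ x ^ 3 - y ^ 2) ∧
  ¬ ((3 : ℤ) ^ 4 ∣ x ∧ (3 : ℤ) ^ 9 ∣ y ∧ (3 : ℤ) ^ 12 * 1728 ∣ x ^ 3 - y ^ 2)

/-- The weighted thin strong-Hall inequality at level `(θ, ε, K, C)` for one pair `(x, y)`, under an extra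
regime hypothesis `R x y`. Inputs: `z := x³ − y² ≠ 0` with `1728 ∣ z` (so `Δ := z/1728 ∈ ℤ`), `Prim23 x y`,
no prime `p ≥ 5` dividing both `x` and `z` (minimality + semistability at `p ≥ 5`), and the THINNESS
`wt5 z ≤ K·(rad5 z)^θ`; output: `max(|z|, |x|³) ≤ C·(rad5 z · wt5 z)^{6+ε}`. -/
def HallIneq (R : ℤ → ℤ → Prop) (θ ε K C : ℝ) : Prop :=
  ∀ x y : ℤ, x ^ 3 - y ^ 2 ≠ 0 → (1728 : ℤ) ∣ x ^ 3 - y ^ 2 → Prim23 x y → R x y →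
    (∀ p : ℕ, p.Prime → 5 ≤ p → (p : ℤ) ∣ x → ¬ (p : ℤ) ∣ x ^ 3 - y ^ 2) →
    (wt5 (x ^ 3 - y ^ 2) : ℝ) ≤ K * (rad5 (x ^ 3 - y ^ 2) : ℝ) ^ θ →
    ((max |x ^ 3 - y ^ 2| (|x| ^ 3) : ℤ) : ℝ) ≤
      C * ((rad5 (x ^ 3 - y ^ 2) : ℝ) * (wt5 (x ^ 3 - y ^ 2) : ℝ)) ^ (6 + ε)

/-- `ThinLaw R`: `∃ θ > 0, ∀ ε > 0, ∀ K, ∃ C, HallIneq R θ ε K C` — the crux's quantifier shape (class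
exponent `θ` frozen OUTSIDE `∀ε ∀K`). -/
def ThinLaw (R : ℤ → ℤ → Prop) : Prop :=
  ∃ θ : ℝ, 0 < θ ∧ ∀ ε : ℝ, 0 < ε → ∀ K : ℝ, ∃ C : ℝ, HallIneq R θ ε K C

/-- **ThinStrongHall** — the ℕ normal form of `RibetTakahashiSplit.ThinWeightedSzpiro` (no regime
hypothesis). `ThinStrongHall → ThinWeightedSzpiro` is the composition of the landed stubs `stub_transfer`,
`stub_localData`, `stub_weights`; `StrongHallConjecture → ThinStrongHall` (calibration file attached to the item
stmt-ABC-17927), so it is implied by `abc`. Open (abc-strength on the thin class). -/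
def ThinStrongHall : Prop := ThinLaw fun _ _ => True

/-- Cusp half of the normal form: regime `|x³ − y²| ≤ |x|³`, i.e. `|j| ≥ 1728` — the HALL CORNER (contains
every Frey curve, `freyCurve_cusp`). Open: its kernel on `z` with squarefree prime-to-`6` part is weak Hall
`|x| ≪ rad(z)^{2+ε}`. -/
def ThinStrongHallCusp : Prop := ThinLaw fun x y => |x ^ 3 - y ^ 2| ≤ |x| ^ 3

/-- Bulk half of the normal form: regime `|x|³ < |x³ − y²|` — weighted Szpiro for a balanced difference of a
cube and a square on the thin class. Open: on `(x, y) = (1, 2^{n+1}+1)` it asserts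
`rad5(2ⁿ+1)·wt5(2ⁿ+1) ≫ 4^{n/(6+ε)}` for thin `2ⁿ + 1` (calibration file attached to the item). -/
def ThinStrongHallBulk : Prop := ThinLaw fun x y => |x| ^ 3 < |x ^ 3 - y ^ 2|

/-! ## Elementary API -/

/-- `rad5 z ≥ 1` (a product of primes; empty product for `z = 0`). -/
theorem one_le_rad5 (z : ℤ) : 1 ≤ rad5 z := by
  unfold rad5
  rw [Nat.one_le_iff_ne_zero, Finset.prod_ne_zero_iff]
  intro p hp
  rw [Finset.mem_filter] at hp
  omega

/-- `wt5 z ≥ 1` (every factor `v_p(z)`, `p ∣ z ≠ 0`, is positive; empty product for `z = 0`). -/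
theorem one_le_wt5 (z : ℤ) : 1 ≤ wt5 z := by
  unfold wt5
  rw [Nat.one_le_iff_ne_zero, Finset.prod_ne_zero_iff]
  intro p hp
  rw [Finset.mem_filter] at hp
  obtain ⟨hpr, hdvd, hne⟩ := Nat.mem_primeFactors.mp hp.1
  exact (hpr.factorization_pos_of_dvd hne hdvd).ne'

/-- Monotonicity of thinness in the class exponent: a `θ`-thin `z` is `θ'`-thin for `θ ≤ θ'` (when `0 ≤ K`). -/
theorem thin_mono {θ θ' K : ℝ} (hθ : θ ≤ θ') (hK : 0 ≤ K) (z : ℤ)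
    (h : (wt5 z : ℝ) ≤ K * (rad5 z : ℝ) ^ θ) : (wt5 z : ℝ) ≤ K * (rad5 z : ℝ) ^ θ' := by
  refine h.trans (mul_le_mul_of_nonneg_left ?_ hK)
  exact Real.rpow_le_rpow_of_exponent_le (by exact_mod_cast one_le_rad5 z) hθ

/-- Weakening the regime hypothesis: `ThinLaw R' → ThinLaw R` whenever `R ⇒ R'`. -/
theorem ThinLaw.mono {R R' : ℤ → ℤ → Prop} (hRR' : ∀ x y, R x y → R' x y) (h : ThinLaw R') :
    ThinLaw R := by
  obtain ⟨θ, hθ, h⟩ := h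
  refine ⟨θ, hθ, fun ε hε K => ?_⟩
  obtain ⟨C, hC⟩ := h ε hε K
  exact ⟨C, fun x y hz h1728 hprim hR hcop hthin => hC x y hz h1728 hprim (hRR' x y hR) hcop hthin⟩

/-- The normal form implies its cusp half. -/
theorem thinStrongHallCusp_of_thinStrongHall (h : ThinStrongHall) : ThinStrongHallCusp :=
  ThinLaw.mono (fun _ _ _ => trivial) h

/-- The normal form implies its bulk half. -/
theorem thinStrongHallBulk_of_thinStrongHall (h : ThinStrongHall) : ThinStrongHallBulk :=
  ThinLaw.mono (fun _ _ _ => trivial) h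

/-- GLUE: the two regimes compose to the normal form, with class exponent `min θ₁ θ₂` (for `K < 0` the
thinness hypothesis is unsatisfiable since `wt5 ≥ 0` and `rad5 ≥ 1`). -/
theorem thinStrongHall_of_cusp_of_bulk (hc : ThinStrongHallCusp) (hb : ThinStrongHallBulk) :
    ThinStrongHall := by
  obtain ⟨θ₁, hθ₁, h₁⟩ := hc
  obtain ⟨θ₂, hθ₂, h₂⟩ := hb
  refine ⟨min θ₁ θ₂, lt_min hθ₁ hθ₂, fun ε hε K => ?_⟩
  obtain ⟨C₁, hC₁⟩ := h₁ ε hε K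
  obtain ⟨C₂, hC₂⟩ := h₂ ε hε K
  refine ⟨max C₁ C₂, fun x y hz h1728 hprim _ hcop hthin => ?_⟩
  have hbase : (0 : ℝ) ≤ ((rad5 (x ^ 3 - y ^ 2) : ℝ) * (wt5 (x ^ 3 - y ^ 2) : ℝ)) ^ (6 + ε) := by
    positivity
  by_cases hK : 0 ≤ K
  · rcases le_or_gt |x ^ 3 - y ^ 2| (|x| ^ 3) with hcusp | hbulk
    · exact (hC₁ x y hz h1728 hprim hcusp hcop (thin_mono (min_le_left _ _) hK _ hthin)).trans
        (mul_le_mul_of_nonneg_right (le_max_left _ _) hbase)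
    · exact (hC₂ x y hz h1728 hprim hbulk hcop (thin_mono (min_le_right _ _) hK _ hthin)).trans
        (mul_le_mul_of_nonneg_right (le_max_right _ _) hbase)
  · -- `K < 0`: the thinness hypothesis is unsatisfiable (`wt5 ≥ 0 > K·rad5^θ`), so the goal is vacuous
    exfalso
    set z : ℤ := x ^ 3 - y ^ 2 with hzdef
    have h1 : (1 : ℝ) ≤ (rad5 z : ℝ) := by exact_mod_cast one_le_rad5 z
    have h0 : (0 : ℝ) < (rad5 z : ℝ) ^ (min θ₁ θ₂) := Real.rpow_pos_of_pos (by linarith) _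
    have hneg : K * (rad5 z : ℝ) ^ (min θ₁ θ₂) < 0 := mul_neg_of_neg_of_pos (lt_of_not_ge hK) h0
    have hw : (0 : ℝ) ≤ (wt5 z : ℝ) := by positivity
    linarith

/-- Registered glue stub of the line (skeleton `Lines/Sketch.lean` rev L3, composition
`ThinWeightedSzpiro_of := stub_transfer stub_localData stub_weights (stub_glue stub_cusp stub_bulk)`), under
its registered name: the two regimes compose to the normal form (`= thinStrongHall_of_cusp_of_bulk`). -/
theorem stub_glue : ThinStrongHallCusp → ThinStrongHallBulk → ThinStrongHall :=
  thinStrongHall_of_cusp_of_bulk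

/-- The normal form is exactly the conjunction of its two halves. -/
theorem thinStrongHall_iff_cusp_and_bulk :
    ThinStrongHall ↔ ThinStrongHallCusp ∧ ThinStrongHallBulk :=
  ⟨fun h => ⟨thinStrongHallCusp_of_thinStrongHall h, thinStrongHallBulk_of_thinStrongHall h⟩,
    fun h => thinStrongHall_of_cusp_of_bulk h.1 h.2⟩

/-- **Frey cusp lemma**: `1728·Δ ≤ c₄³` for every Frey–Hellegouarch curve `y² = x(x − a)(x + b)`
(`Literature.NumberTheory.EllipticCurves.freyCurve a b`), i.e. `j ≥ 1728` whenever `Δ ≠ 0` — from the identity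
`4(a² + ab + b²)³ − 27(ab(a + b))² = ((a − b)(2a + b)(a + 2b))²` (discriminant of the 2-division cubic with
integer roots `0, a, −b`). So Frey curves live in the cusp regime only: the route's `closes` instantiates the
cusp half of the normal form, never the bulk. -/
theorem freyCurve_cusp (a b : ℤ) : 1728 * (freyCurve a b).Δ ≤ (freyCurve a b).c₄ ^ 3 := by
  have hc : (freyCurve a b).c₄ = 16 * ((a : ℚ) ^ 2 + a * b + b ^ 2) := by
    simp only [WeierstrassCurve.c₄, WeierstrassCurve.b₂, WeierstrassCurve.b₄, freyCurve_a₁,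
      freyCurve_a₂, freyCurve_a₃, freyCurve_a₄]
    ring
  rw [freyCurve_Δ, hc]
  nlinarith [sq_nonneg (((a : ℚ) - b) * (2 * a + b) * (a + 2 * b))]

end Summit.ABC.ABC.Theorems.ThinWeightedSzpiro
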